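import Mathlib
import Summits.CriticalPhenomena.Ising3DConformalLimit.Theorems.MarkovRigidityFieldRealisationLatticeField
import Summits.CriticalPhenomena.Ising3DConformalLimit.Theorems.MarkovRigidityFieldRealisationCriticalMeasure
import Literature.MathematicalPhysics.QuantumLattice.EuclideanAction
import HarnessLib

/-!
# Route MarkovRigidity, support item `FieldRealisation` (stmt-CriticalPhenomena-11245):
# reflection positivity of the smeared critical field at finite mesh

Helper towards clause (b) of `FieldRealisation` (OS3 for the continuum law is the limit of this).
For the smeared laws `P = spinFieldLaw ν (box 3 M) δ r` under a critical DLR state `ν` carrying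
the plus correlations, test functions `f₁,…,fₙ` supported in the open positive half-space
`{x₀ > 0}` and complex coefficients `c₁,…,cₙ`,
`Σᵢⱼ c̄ᵢ cⱼ S_P(fⱼ − Θfᵢ)` is a nonnegative real (`genFunctional_spinFieldLaw_reflectionPositive`).
Proof: under the smearing the continuum time reflection `Θ` becomes the site mirror
`θ₀ : x ↦ (−x₀, x₁, x₂)` of `ℤ³` acting on configurations (`spinField_thetaTest`: the centred
boxes are mirror symmetric), so the double sum is `∫ F(σ) conj(F(σ∘θ₀)) dν(σ)` with the
trigonometric polynomial `F = Σⱼ cⱼ exp(iΦ(fⱼ))` of the spins in the positive half-lattice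
(`x₀ ≥ 1`, since `δ x ∈ tsupport fⱼ` forces `x₀ > 0`); its real part is
`∫ u·(u∘θ₀) + ∫ v·(v∘θ₀) ≥ 0` by reflection positivity of `ν` through the site plane `{x₀ = 0}`
(`integral_mirror_mul_self_nonneg`) and its imaginary part `∫ v·(u∘θ₀) − ∫ u·(v∘θ₀)` vanishes by
mirror invariance of `ν` (`integral_comp_mirror`).

References: Fröhlich–Israel–Lieb–Simon 1978 §2–3; Glimm–Jaffe 1987 §6.1 (OS3);
Osterwalder–Schrader 1973 §2.  No definitions are introduced.
-/

noncomputable section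

namespace Summit.CriticalPhenomena.Ising3DConformalLimit.MarkovRigidityFieldRealisation

open MeasureTheory Filter Complex Literature.Probability.LatticeModels
  Literature.MathematicalPhysics.QuantumLattice
open Summit.CriticalPhenomena.Ising3DConformalLimit
open scoped Topology ComplexConjugate

variable {ν : Measure (SpinConfig (Site 3))}

/-! ### The continuum time reflection under the smearing -/

/-- `θ (δ • x) = δ • θ₀ x` for lattice sites: the continuum time reflection of a rescaled site is
the rescaled mirror site. [folklore] -/
theorem timeReflection_smul_siteToE (δ : ℝ) (x : Site 3) :
    timeReflection 3 (δ • siteToE x) = δ • siteToE (Function.update x 0 (-x 0)) := by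
  ext i
  rw [timeReflection_apply]
  by_cases hi : i = 0
  · subst hi; simp [siteToE]
  · simp [siteToE, hi]

/-- **The smeared field intertwines `Θ` with the site mirror**: on a centred box,
`Φ(Θf)(σ) = Φ(f)(σ ∘ θ₀)`. [cite: OS1973, §2] -/
theorem spinField_thetaTest (M : ℕ) (δ r : ℝ) (σ : SpinConfig (Site 3))
    (f : SchwartzMap (EuclideanSpace ℝ (Fin 3)) ℝ) :
    spinField (box 3 M) δ r σ (thetaTest 3 f) =
      spinField (box 3 M) δ r (fun x => σ (Function.update x 0 (-x 0))) f := by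
  rw [spinField_apply_eq_sum, spinField_apply_eq_sum]
  set θ : Site 3 ≃ Site 3 := Function.Involutive.toPerm _
    (Cruxes.InversionUpgradeNormalised.FreeEndpointGaussianClosure.mirror_involutive (0 : Fin 3)) with hθ
  have hθapp : ∀ x : Site 3, θ x = Function.update x 0 (-x 0) := fun x => rfl
  -- reindex the sum by the mirror: the term at `x` on the left is the term at `θ x` on the right
  refine Finset.sum_equiv θ (fun x =>
    Cruxes.InversionUpgradeNormalised.FreeEndpointGaussianClosure.mem_box_iff_mirror_mem_box 0 M x)
    fun x _ => ?_
  rw [thetaTest_apply, timeReflection_smul_siteToE, hθapp]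
  simp only [spinAt]
  have hinv : Function.update (Function.update x 0 (-x 0)) 0 (-(Function.update x 0 (-x 0)) 0) = x :=
    Cruxes.InversionUpgradeNormalised.FreeEndpointGaussianClosure.mirror_involutive 0 x
  rw [hinv]

/-! ### The trigonometric polynomial as a local observable -/

/-- A test function supported in `{x₀ > 0}` vanishes at every rescaled site with `x₀ ≤ 0`
(`δ > 0`). [folklore] -/
theorem apply_smul_siteToE_eq_zero {δ : ℝ} (hδ : 0 < δ)
    {f : SchwartzMap (EuclideanSpace ℝ (Fin 3)) ℝ}
    (hf : tsupport ⇑f ⊆ {x : EuclideanSpace ℝ (Fin 3) | 0 < x 0}) {x : Site 3} (hx : x 0 ≤ 0) :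
    f (δ • siteToE x) = 0 := by
  refine image_eq_zero_of_notMem_tsupport fun h => ?_
  have h' := hf h
  simp only [Set.mem_setOf_eq, PiLp.smul_apply, siteToE_apply, smul_eq_mul] at h'
  have : (x 0 : ℝ) ≤ 0 := by exact_mod_cast hx
  nlinarith

/-- The smeared field of a test function supported in `{x₀ > 0}`, as a function of the spin
field: `Φ(f)(σ) = Σ_{x ∈ Λ, x₀ ≥ 1} c_x σ_x`. [folklore] -/
theorem spinField_eq_sum_filter {δ : ℝ} (hδ : 0 < δ) (Λ : Finset (Site 3)) (r : ℝ)
    (σ : SpinConfig (Site 3)) {f : SchwartzMap (EuclideanSpace ℝ (Fin 3)) ℝ}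
    (hf : tsupport ⇑f ⊆ {x : EuclideanSpace ℝ (Fin 3) | 0 < x 0}) :
    spinField Λ δ r σ f =
      ∑ x ∈ Λ.filter (fun x : Site 3 => 1 ≤ x 0), (r * δ ^ 3 * f (δ • siteToE x)) * spinAt x σ := by
  rw [spinField_apply_eq_sum, Finset.sum_filter]
  refine Finset.sum_congr rfl fun x _ => ?_
  split_ifs with hx
  · rfl
  · rw [apply_smul_siteToE_eq_zero hδ hf (by omega), mul_zero, zero_mul]

/-! ### Reflection positivity at finite mesh -/


/-- **Reflection positivity of the smeared critical field at finite mesh** (OS3 on the lattice):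
for a critical DLR state `ν` carrying the plus correlations, a centred box, `δ > 0`, test functions
supported in `{x₀ > 0}` and complex coefficients, `Σᵢⱼ c̄ᵢ cⱼ S_P(fⱼ − Θfᵢ)` is a nonnegative real.
[cite: FrohlichEtAl1978, §3 Thm 3.1] -/
theorem genFunctional_spinFieldLaw_reflectionPositive [IsProbabilityMeasure ν]
    (hνG : ν ∈ isingGibbsMeasures 3 (criticalBeta 3) 0)
    (hν : ∀ A : Finset (Site 3), spinCorr ν A = plusCorr 3 (criticalBeta 3) 0 A)
    (M : ℕ) {δ : ℝ} (hδ : 0 < δ) (r : ℝ) {n : ℕ} (c : Fin n → ℂ)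
    (f : Fin n → SchwartzMap (EuclideanSpace ℝ (Fin 3)) ℝ)
    (hf : ∀ i, tsupport ⇑(f i) ⊆ {x : EuclideanSpace ℝ (Fin 3) | 0 < x 0}) :
    0 ≤ (∑ i, ∑ j, conj (c i) * c j *
      genFunctional (spinFieldLaw ν (box 3 M) δ r) (f j - thetaTest 3 (f i))).re ∧
    (∑ i, ∑ j, conj (c i) * c j *
      genFunctional (spinFieldLaw ν (box 3 M) δ r) (f j - thetaTest 3 (f i))).im = 0 := by
  classical
  -- weights, supported in the positive half-lattice
  set D : Finset (Site 3) := (box 3 M).filter (fun x : Site 3 => 1 ≤ x 0) with hD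
  have hDpos : ∀ x ∈ D, 0 ≤ x 0 := fun x hx => by
    have := (Finset.mem_filter.1 hx).2; omega
  set a : Fin n → Site 3 → ℝ := fun j x => r * δ ^ 3 * f j (δ • siteToE x) with ha
  -- the trigonometric polynomial as a function of the spin field
  set Fs : (Site 3 → ℝ) → ℂ := fun s => ∑ j, c j * cexp (I * ((∑ x ∈ D, a j x * s x : ℝ) : ℂ)) with hFs
  have hFsloc : ∀ s t : Site 3 → ℝ, (∀ x ∈ D, s x = t x) → Fs s = Fs t := by
    intro s t hst
    simp only [hFs]
    refine Finset.sum_congr rfl fun j _ => ?_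
    rw [Finset.sum_congr rfl fun x hx => by rw [hst x hx]]
  have hX : ∀ (j : Fin n) (σ : SpinConfig (Site 3)),
      spinField (box 3 M) δ r σ (f j) = ∑ x ∈ D, a j x * spinAt x σ := fun j σ =>
    spinField_eq_sum_filter hδ (box 3 M) r σ (hf j)
  -- real and imaginary parts as real local observables
  set Φu : (Site 3 → ℝ) → ℝ := fun s => (Fs s).re with hΦu
  set Φv : (Site 3 → ℝ) → ℝ := fun s => (Fs s).im with hΦv
  have hΦuloc : ∀ s t : Site 3 → ℝ, (∀ x ∈ D, s x = t x) → Φu s = Φu t := fun s t h => by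
    simp only [hΦu, hFsloc s t h]
  have hΦvloc : ∀ s t : Site 3 → ℝ, (∀ x ∈ D, s x = t x) → Φv s = Φv t := fun s t h => by
    simp only [hΦv, hFsloc s t h]
  have hFscont : Continuous Fs := by
    simp only [hFs]
    refine continuous_finsetSum _ fun j _ => continuous_const.mul (Complex.continuous_exp.comp
      (continuous_const.mul (Complex.continuous_ofReal.comp ?_)))
    exact continuous_finsetSum _ fun x _ => continuous_const.mul (continuous_apply x)
  have hsf : Measurable fun σ : SpinConfig (Site 3) => fun x => spinAt x σ :=
    measurable_pi_lambda _ fun x => measurable_spinAt x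
  have hΦum : Measurable fun σ : SpinConfig (Site 3) => Φu (fun x => spinAt x σ) :=
    (Complex.measurable_re.comp hFscont.measurable).comp hsf
  have hΦvm : Measurable fun σ : SpinConfig (Site 3) => Φv (fun x => spinAt x σ) :=
    (Complex.measurable_im.comp hFscont.measurable).comp hsf
  have hFsbd : ∀ s, ‖Fs s‖ ≤ ∑ j, ‖c j‖ := fun s => by
    simp only [hFs]
    refine (norm_sum_le _ _).trans (Finset.sum_le_sum fun j _ => ?_)
    rw [norm_mul, Complex.norm_exp_I_mul_ofReal, mul_one]
  have hΦub : ∃ C, ∀ σ : SpinConfig (Site 3), |Φu (fun x => spinAt x σ)| ≤ C :=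
    ⟨∑ j, ‖c j‖, fun σ => (Complex.abs_re_le_norm _).trans (hFsbd _)⟩
  have hΦvb : ∃ C, ∀ σ : SpinConfig (Site 3), |Φv (fun x => spinAt x σ)| ≤ C :=
    ⟨∑ j, ‖c j‖, fun σ => (Complex.abs_im_le_norm _).trans (hFsbd _)⟩
  -- reflection positivity and mirror invariance of `ν`
  have hRPu := integral_mirror_mul_self_nonneg hν D hDpos Φu hΦuloc hΦum hΦub
  have hRPv := integral_mirror_mul_self_nonneg hν D hDpos Φv hΦvloc hΦvm hΦvb
  have hsym := integral_comp_mirror hνG (F := fun σ : SpinConfig (Site 3) =>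
    Φv (fun x => spinAt x σ) * Φu (fun x => spinAt (Function.update x 0 (-x 0)) σ))
    (hΦvm.mul (hΦum.comp measurable_mirrorConfig))
  -- identify the double sum with `∫ F(σ) conj(F(σ ∘ θ₀)) dν`
  set R : SpinConfig (Site 3) → SpinConfig (Site 3) := fun σ x => σ (Function.update x 0 (-x 0)) with hR
  have hFσ : ∀ σ : SpinConfig (Site 3), Fs (fun x => spinAt x σ) =
      ∑ j, c j * cexp (I * ((spinField (box 3 M) δ r σ (f j) : ℝ) : ℂ)) := fun σ => by
    simp only [hFs, hX]
  have hFR : ∀ σ : SpinConfig (Site 3), Fs (fun x => spinAt x (R σ)) =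
      ∑ i, c i * cexp (I * ((spinField (box 3 M) δ r σ (thetaTest 3 (f i)) : ℝ) : ℂ)) := fun σ => by
    simp only [hFs, spinField_thetaTest, hX, hR]
  have hterm : ∀ σ : SpinConfig (Site 3), ∑ i, ∑ j, conj (c i) * c j *
      cexp (I * ((spinField (box 3 M) δ r σ (f j - thetaTest 3 (f i)) : ℝ) : ℂ)) =
      Fs (fun x => spinAt x σ) * conj (Fs (fun x => spinAt x (R σ))) := by
    intro σ
    rw [hFσ, hFR, map_sum, Finset.sum_mul_sum, Finset.sum_comm]
    refine Finset.sum_congr rfl fun i _ => Finset.sum_congr rfl fun j _ => ?_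
    rw [map_sub, map_mul, ← Complex.exp_conj, map_mul, Complex.conj_I, Complex.conj_ofReal]
    push_cast
    rw [mul_sub, Complex.exp_sub, div_eq_mul_inv, ← Complex.exp_neg]
    ring_nf
  -- integrability of bounded continuous functions of the spins
  have hint : ∀ (G : SpinConfig (Site 3) → ℂ), Measurable G → (∀ σ, ‖G σ‖ ≤ (∑ j, ‖c j‖) ^ 2) →
      Integrable G ν := fun G hG hb =>
    Integrable.of_bound hG.aestronglyMeasurable _ (Eventually.of_forall hb)
  have hmeasF : Measurable fun σ : SpinConfig (Site 3) => Fs (fun x => spinAt x σ) :=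
    hFscont.measurable.comp hsf
  have hmeasFR : Measurable fun σ : SpinConfig (Site 3) => Fs (fun x => spinAt x (R σ)) := by
    have : (fun σ : SpinConfig (Site 3) => Fs (fun x => spinAt x (R σ))) =
        (fun σ => Fs (fun x => spinAt x σ)) ∘ R := rfl
    rw [this]
    exact hmeasF.comp measurable_mirrorConfig
  have hsum : ∑ i, ∑ j, conj (c i) * c j *
      genFunctional (spinFieldLaw ν (box 3 M) δ r) (f j - thetaTest 3 (f i)) =
      ∫ σ, Fs (fun x => spinAt x σ) * conj (Fs (fun x => spinAt x (R σ))) ∂ν := by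
    simp_rw [genFunctional_spinFieldLaw, ← hterm]
    rw [integral_finsetSum _ fun i _ => ?_]
    · refine Finset.sum_congr rfl fun i _ => ?_
      rw [integral_finsetSum _ fun j _ => ?_]
      · refine Finset.sum_congr rfl fun j _ => ?_
        rw [← integral_const_mul]
      · refine (Integrable.of_bound ?_ 1 (Eventually.of_forall fun σ => ?_)).const_mul _
        · exact (Complex.continuous_exp.comp (continuous_const.mul Complex.continuous_ofReal)).measurable.comp
            ((measurable_eval _).comp (measurable_spinField _ δ r)) |>.aestronglyMeasurable
        · rw [Complex.norm_exp_I_mul_ofReal]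
    · refine integrable_finsetSum _ fun j _ => ?_
      refine (Integrable.of_bound ?_ 1 (Eventually.of_forall fun σ => ?_)).const_mul _
      · exact (Complex.continuous_exp.comp (continuous_const.mul Complex.continuous_ofReal)).measurable.comp
          ((measurable_eval _).comp (measurable_spinField _ δ r)) |>.aestronglyMeasurable
      · rw [Complex.norm_exp_I_mul_ofReal]
  rw [hsum]
  -- bounded pieces
  set u : SpinConfig (Site 3) → ℝ := fun σ => Φu (fun x => spinAt x σ) with hu
  set v : SpinConfig (Site 3) → ℝ := fun σ => Φv (fun x => spinAt x σ) with hv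
  set B : ℝ := ∑ j, ‖c j‖ with hB
  have hB0 : 0 ≤ B := Finset.sum_nonneg fun j _ => norm_nonneg _
  have hRR : ∀ σ : SpinConfig (Site 3), R (R σ) = σ := fun σ => by
    funext x
    simp only [hR]
    exact congrArg σ (Cruxes.InversionUpgradeNormalised.FreeEndpointGaussianClosure.mirror_involutive 0 x)
  have huB : ∀ σ, |u σ| ≤ B := fun σ => (Complex.abs_re_le_norm _).trans (hFsbd _)
  have hvB : ∀ σ, |v σ| ≤ B := fun σ => (Complex.abs_im_le_norm _).trans (hFsbd _)
  have hum : Measurable u := hΦum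
  have hvm : Measurable v := hΦvm
  have huRm : Measurable fun σ => u (R σ) := hΦum.comp measurable_mirrorConfig
  have hvRm : Measurable fun σ => v (R σ) := hΦvm.comp measurable_mirrorConfig
  have hbdd : ∀ (g : SpinConfig (Site 3) → ℝ), Measurable g → (∀ σ, |g σ| ≤ B * B) →
      Integrable g ν := fun g hg hb =>
    Integrable.of_bound hg.aestronglyMeasurable _ (Eventually.of_forall fun σ => by
      rw [Real.norm_eq_abs]; exact hb σ)
  have hprodB : ∀ (p q : ℝ), |p| ≤ B → |q| ≤ B → |p * q| ≤ B * B := fun p q hp hq => by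
    rw [abs_mul]; exact mul_le_mul hp hq (abs_nonneg _) hB0
  have huuR : Integrable (fun σ => u σ * u (R σ)) ν :=
    hbdd _ (hum.mul huRm) fun σ => hprodB _ _ (huB σ) (huB (R σ))
  have hvvR : Integrable (fun σ => v σ * v (R σ)) ν :=
    hbdd _ (hvm.mul hvRm) fun σ => hprodB _ _ (hvB σ) (hvB (R σ))
  have hvuR : Integrable (fun σ => v σ * u (R σ)) ν :=
    hbdd _ (hvm.mul huRm) fun σ => hprodB _ _ (hvB σ) (huB (R σ))
  have huvR : Integrable (fun σ => u σ * v (R σ)) ν :=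
    hbdd _ (hum.mul hvRm) fun σ => hprodB _ _ (huB σ) (hvB (R σ))
  have hprod : Integrable (fun σ : SpinConfig (Site 3) =>
      Fs (fun x => spinAt x σ) * conj (Fs (fun x => spinAt x (R σ)))) ν := by
    refine Integrable.of_bound ((hmeasF.mul (Complex.continuous_conj.measurable.comp hmeasFR)).aestronglyMeasurable)
      (B * B) (Eventually.of_forall fun σ => ?_)
    rw [norm_mul, RCLike.norm_conj]
    exact mul_le_mul (hFsbd _) (hFsbd _) (norm_nonneg _) hB0
  -- real and imaginary parts of the integrand
  have hre : ∀ σ : SpinConfig (Site 3),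
      (Fs (fun x => spinAt x σ) * conj (Fs (fun x => spinAt x (R σ)))).re =
        u σ * u (R σ) + v σ * v (R σ) := fun σ => by
    simp only [hu, hv, hΦu, hΦv, Complex.mul_re, Complex.conj_re, Complex.conj_im]; ring
  have him : ∀ σ : SpinConfig (Site 3),
      (Fs (fun x => spinAt x σ) * conj (Fs (fun x => spinAt x (R σ)))).im =
        v σ * u (R σ) - u σ * v (R σ) := fun σ => by
    simp only [hu, hv, hΦu, hΦv, Complex.mul_im, Complex.conj_re, Complex.conj_im]; ring
  have hR1 : (∫ σ, Fs (fun x => spinAt x σ) * conj (Fs (fun x => spinAt x (R σ))) ∂ν).re =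
      ∫ σ, (Fs (fun x => spinAt x σ) * conj (Fs (fun x => spinAt x (R σ)))).re ∂ν := by
    have h := integral_re hprod
    simp only [RCLike.re_to_complex] at h
    exact h.symm
  have hR2 : (∫ σ, Fs (fun x => spinAt x σ) * conj (Fs (fun x => spinAt x (R σ))) ∂ν).im =
      ∫ σ, (Fs (fun x => spinAt x σ) * conj (Fs (fun x => spinAt x (R σ)))).im ∂ν := by
    have h := integral_im hprod
    simp only [RCLike.im_to_complex] at h
    exact h.symm
  constructor
  · rw [hR1]
    simp_rw [hre]
    rw [integral_add huuR hvvR]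
    have e1 : ∫ σ, u σ * u (R σ) ∂ν =
        ∫ σ, Φu (fun x => spinAt (Function.update x 0 (-x 0)) σ) * Φu (fun x => spinAt x σ) ∂ν := by
      refine integral_congr_ae (Eventually.of_forall fun σ => ?_)
      simp only [hu, hR, spinAt]; ring
    have e2 : ∫ σ, v σ * v (R σ) ∂ν =
        ∫ σ, Φv (fun x => spinAt (Function.update x 0 (-x 0)) σ) * Φv (fun x => spinAt x σ) ∂ν := by
      refine integral_congr_ae (Eventually.of_forall fun σ => ?_)
      simp only [hv, hR, spinAt]; ring
    rw [e1, e2]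
    exact add_nonneg hRPu hRPv
  · rw [hR2]
    simp_rw [him]
    rw [integral_sub hvuR huvR, sub_eq_zero]
    -- mirror invariance: `∫ u(σ) v(Rσ) = ∫ v(σ) u(Rσ)`
    have h1 : ∫ σ, (fun τ : SpinConfig (Site 3) => v τ * u (R τ)) (R σ) ∂ν =
        ∫ σ, v σ * u (R σ) ∂ν := by
      have h := hsym
      simp only [hu, hv, hR] at h ⊢
      exact h
    rw [← h1]
    refine integral_congr_ae (Eventually.of_forall fun σ => ?_)
    simp only [hRR]; ring

end Summit.CriticalPhenomena.Ising3DConformalLimit.MarkovRigidityFieldRealisation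


end
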